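import Summits.QuantumFields.BalabanUV.Beta.EriceFlowEnclosureB12AsPrintedLowerEnd
import Literature.MathematicalPhysics.QuantumFieldTheory.Balaban1983to89.Beta.AveragedAFCarrier

/-!
# Beta / EriceFlowEnclosureB12AsPrintedAvgAF — the CAP end-grade carrier `BetaAvgAFH` (averaged asymptotic freedom with slope s and defect D)
# READ ON THE AS-PRINTED CARRIER OF [I]: what it gives of Theorem 2 there (the first sentence, (0.20) along the run, (0.31) WITH A DEFECT,
# the literal lower half on every long final window) and what Theorem 2 as printed gives back of it along the tuned runs (β-flow team,
# prover 2 = lower ∕ positivity side, unit `b2b-balaban-beta-bflow-p2`, gen 40; ROW AP-I, lower half × crew CAP's END grade — `bears_on: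
# R4-CAP`, support-class; parts 1–3 = `…B12AsPrintedLower` ∕ `…LowerEnd` ∕ `…EriceJunction`)

HONEST FRAMING (page 1 of everything the β sub-cell writes): discharging `BetaPertH` makes Bałaban's UV stability UNCONDITIONAL — a
real constructive-QFT result; it is NOT the continuum limit and NOT the Clay problem.  HONEST DEPENDENCY (cell reorg 2026-08-19,
verbatim): «continuum YM on T⁴ ⇐ BetaPertH ∧ nine spine estimates (0/9 proved); BetaPertH ⇐ (D1) ∧ (D4) ∧ CAP+tail; G-an2-4 gates
asym, D1 and NE2/3/4.»  THIS MODULE DISCHARGES NOTHING: bookkeeping over the NAMED FIELDS of `B12BetaAsPrinted` ([I] = [Balaban1987RG1] as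
typed, p537882 ✓ ∕ v1.1 p539116 ✓; `Definitions S` = (0.18)∕(0.20) as printed; `Theorem2Statement S hL` = Theorem 2 ∕ (0.31) BY NAME, STATED
WITHOUT PROOF in print) and the tree's END-GRADE CARRIER `Beta.AveragedAFCarrier.BetaAvgAFH s D γ β` («along every history in ]0, γ], every
window sum `Σ_{j∈[k,n)} β_{j+1}(g₀, …, g_j) ≥ s(n − k) − D`» — for Bałaban's (1.22) a located UNPRINTED input, BETA-SPEC §7; the grade through
which crew CAP's roads are consumed, `AveragedAFCarrierCertified.betaAvgAFH_of_certifiedConst_list` = LADDER-YM N25∕B3 socket e3) as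
displayed HYPOTHESES.  Nothing of [I] asserted; no field is claimed for Bałaban's objects.

WHAT THIS FILE PROVES (0 sorry, 0 def):
§1 `lower_running_of_avgAFH` — along a run lying in ]0, γ] up to K and obeying (0.20) at its own histories, `BetaAvgAFH s D γ S.β` gives
   `1∕g_K² + s(K − k) − D ≤ 1∕g_k²` for every k ≤ K ((0.31)'s lower half WITH A DEFECT D; `BetaAvgAFH.onHorizon` + `FlowStep.inv_sq_telescopeH`),
   and `lower_running_window_of_avgAFH` — on the final windows with `2D ≤ s(K − k)` the LITERAL lower half with β = s∕2.
§2 **`firstSentence_of_avgAFH`** — `Definitions S` + joint continuity + the printed-type upper bound β′ + `BetaAvgAFH s D γ₀ S.β` with s ≥ 0 ⟹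
   for every γ ∈ ]0, γ₀], every g > 0 with `1∕g² ≥ 1∕γ² + D` and every K a bare coupling g₀ = g₀(ε, g) whose run lies in ]0, γ], ends at g_K = g,
   OBEYS (0.20), and satisfies **`1∕g² + s(K − k) − D ≤ 1∕g_k² ≤ 1∕g² + β′(K − k)`** (k ≤ K) — Theorem 2's FIRST SENTENCE and its (0.31) UP TO THE
   DEFECT D, on the as-printed carrier, from the END grade (part 2's `firstSentence_of_partialSums` via `BetaAvgAFH.partialSums`, then §1);
   `endpoint_of_avgAFH` (Theorem 2's quantifier shape, g₁ = (1∕γ² + D)^{−1∕2}).  The LITERAL `Theorem2Statement` ((0.31) at EVERY k ≤ K) does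
   NOT follow from the carrier with D > 0 (history-level witness `AveragedAFCarrier.betaO`: negative at odd steps, `literal_carrier_outside_gloss2`;
   at k = K − 1 a negative β_K breaks the left inequality) — not re-built on this carrier.
§3 **`avgAF_along_tuned_of_theorem2Statement`** — CONVERSELY, what Theorem 2 AS PRINTED gives of the carrier: with prover 1's binder `hrg` and
   `Definitions ∧ Conclusions`, along every tuned run EVERY window [k, n) ⊆ [0, K] has `Σ_{j∈[k,n)} β_{j+1}(g₀, …, g_j) ≥ β ln L·(n − k) −
   (β′₅₁₀ − β ln L)(K − n)` — slope β ln L with a defect growing with the distance of the window from the END (both halves of the running: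
   (0.31)'s lower and print's upper); so Theorem 2 yields the END-ANCHORED windows of `BetaAvgAFH` exactly (n = K: defect 0, part 1) and inner
   windows only up to that defect — the carrier proper (all box histories, K-uniform defect) is NOT a consequence of Theorem 2 as printed.
§4 `suffix_lower_of_firstSentence_run` — NECESSITY AT THE END GRADE (s = 0): along ANY run lying in ]0, γ] up to K, obeying (0.20) and ending
   at g_K = g, every suffix sum `Σ_{j∈[k,K)} β_{j+1}(g₀, …, g_j) ≥ 1∕γ² − 1∕g²` (`FlowStepRuns.partialSums_lower_of_run` on the carrier) — so
   Theorem 2's first sentence, read uniformly in K at fixed g (with `hrg`), forces K-UNIFORMLY bounded-below suffix sums along its runs: the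
   END-anchored windows of the s = 0 carrier with defect `1∕g² − 1∕γ²`; `firstSentence_forces_suffix_lower` packages it from `Theorem2Statement`.
NOT CLAIMED: `BetaAvgAFH` or any interface field for the construction; Theorem 2; `BetaPertH`; continuum; Clay.
-/

namespace Summit.QuantumFields.BalabanUV.Beta.EriceFlowEnclosureB12AsPrintedAvgAF

open Literature.MathematicalPhysics.QuantumFieldTheory.Balaban1983to89
open Literature.MathematicalPhysics.QuantumFieldTheory.Balaban1983to89.B12BetaAsPrinted
open Literature.MathematicalPhysics.QuantumFieldTheory.Balaban1983to89.B12Sec2to5 (betaPrime510)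
open Literature.MathematicalPhysics.QuantumFieldTheory.Balaban1983to89.FlowStep (prefixOf Box BetaContH BetaLowerH BetaUpperH)
open Literature.MathematicalPhysics.QuantumFieldTheory.Balaban1983to89.Beta.AveragedAFCarrier (BetaAvgAFH)
open Summit.QuantumFields.BalabanUV.Beta.B12AsPrintedRowD4Junction (abs_beta_prefix_le_betaPrime510)
open Summit.QuantumFields.BalabanUV.Beta.EriceFlowEnclosureB12AsPrintedUpper
open Summit.QuantumFields.BalabanUV.Beta.EriceFlowEnclosureB12AsPrintedTuned
open Summit.QuantumFields.BalabanUV.Beta.EriceFlowEnclosureB12AsPrintedLower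
open Summit.QuantumFields.BalabanUV.Beta.EriceFlowEnclosureB12AsPrintedLowerEnd

noncomputable section

variable {S : Setting}

/-! ## §1 The carrier along a run: (0.31)'s lower half with a defect -/

/-- **(0.31)'s LOWER HALF WITH A DEFECT, along a run, from the END-grade carrier.**  For a run lying in ]0, γ] up to K and obeying (0.20) at its
own histories (`FlowStep.RGEqH`), `BetaAvgAFH s D γ S.β` gives `1∕g_K² + s(K − k) − D ≤ 1∕g_k²` for every k ≤ K (the window [k, K) of the
carrier on the finite horizon, `BetaAvgAFH.onHorizon`, + telescoped (0.20)). [cite: Balaban1987RG1, Thm 2 (0.31) p.259 with (0.20) p.256] -/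
theorem lower_running_of_avgAFH {P : B12.RunParams} {γ s D : ℝ} (hrg : FlowStep.RGEqH P.K S.β (S.cpl P))
    (hI : Step.InInterval γ P.K (S.cpl P)) (h : BetaAvgAFH s D γ S.β) {k : ℕ} (hk : k ≤ P.K) :
    1 / (S.cpl P P.K) ^ 2 + s * ((P.K : ℝ) - k) - D ≤ 1 / (S.cpl P k) ^ 2 := by
  have hw := h.onHorizon (S.cpl P) P.K hI k P.K hk le_rfl
  have ht := FlowStep.inv_sq_telescopeH hrg hk le_rfl
  linarith

/-- **… and the LITERAL lower half on every long final window**: with s > 0, at every k ≤ K with `2D ≤ s(K − k)` the carrier gives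
`1∕g_K² + (s∕2)(K − k) ≤ 1∕g_k²` — (0.31)'s left inequality with β = s∕2 at all steps at distance ≥ 2D∕s from the end; the finitely many last
steps are where a defect D > 0 can break it. [cite: Balaban1987RG1, Thm 2 (0.31) p.259] -/
theorem lower_running_window_of_avgAFH {P : B12.RunParams} {γ s D : ℝ} (hrg : FlowStep.RGEqH P.K S.β (S.cpl P))
    (hI : Step.InInterval γ P.K (S.cpl P)) (h : BetaAvgAFH s D γ S.β) {k : ℕ} (hk : k ≤ P.K)
    (hfar : 2 * D ≤ s * ((P.K : ℝ) - k)) :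
    1 / (S.cpl P P.K) ^ 2 + s / 2 * ((P.K : ℝ) - k) ≤ 1 / (S.cpl P k) ^ 2 := by
  have h1 := lower_running_of_avgAFH hrg hI h hk
  linarith

/-! ## §2 The first sentence of Theorem 2 with (0.20) and the defected (0.31), from the END grade -/

/-- **THEOREM 2's FIRST SENTENCE AND ITS (0.31) UP TO THE DEFECT, ON THE AS-PRINTED CARRIER, FROM THE END-GRADE CARRIER.**  For every setting
with the printed `Definitions` ((0.18), (0.20)): if the history-dependent β-functions are jointly continuous on the boxes ]0, γ₀]^{k+1}, bounded
above by β′ ≥ 0 there, and satisfy `BetaAvgAFH s D γ₀ S.β` with s ≥ 0 (averaged asymptotic freedom with slope s and defect D — the located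
unprinted input in crew CAP's END grade), then for every γ ∈ ]0, γ₀], every g > 0 with `1∕γ² + D ≤ 1∕g²` and every K there is a bare coupling
g₀ whose run (K, m, g₀) lies in ]0, γ], ends at g_K = g, OBEYS (0.20) at its own histories, and satisfies
**`1∕g² + s(K − k) − D ≤ 1∕g_k² ≤ 1∕g² + β′(K − k)`** for every k ≤ K.  (Part 2's `firstSentence_of_partialSums` with M := D
— `BetaAvgAFH.partialSums` —, then §1 along the run obtained.)  A REDUCTION; nothing of [I] asserted. [cite: Balaban1987RG1, Thm 2 (0.31) p.259 with (0.18)–(0.20) pp.255–256] -/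
theorem firstSentence_of_avgAFH (hD : Definitions S) {γ₀ s D β' : ℝ} (hγ₀ : 0 < γ₀) (hs : 0 ≤ s) (hβ' : 0 ≤ β')
    (hcont : BetaContH γ₀ S.β) (havg : BetaAvgAFH s D γ₀ S.β) (hup : BetaUpperH β' γ₀ S.β) (m : ℕ) {γ : ℝ} (hγ : 0 < γ)
    (hγle : γ ≤ γ₀) {g : ℝ} (hg : 0 < g) (hgD : 1 / γ ^ 2 + D ≤ 1 / g ^ 2) (K : ℕ) :
    ∃ g₀ : ℝ, Step.InInterval γ K (S.cpl ⟨K, m, g₀⟩) ∧ S.cpl ⟨K, m, g₀⟩ K = g ∧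
      FlowStep.RGEqH K S.β (S.cpl ⟨K, m, g₀⟩) ∧
      ∀ k, k ≤ K → 1 / g ^ 2 + s * ((K : ℝ) - k) - D ≤ 1 / (S.cpl ⟨K, m, g₀⟩ k) ^ 2 ∧
        1 / (S.cpl ⟨K, m, g₀⟩ k) ^ 2 ≤ 1 / g ^ 2 + β' * ((K : ℝ) - k) := by
  have hDnn : 0 ≤ D := havg.defect_nonneg hγ₀
  obtain ⟨g₀, hI, hend, hrg, hbd⟩ :=
    firstSentence_of_partialSums hD hDnn hβ' hcont (havg.partialSums hs) hup m hγ hγle hg hgD K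
  refine ⟨g₀, hI, hend, hrg, fun k hk => ⟨?_, (hbd k hk).2⟩⟩
  have h1 := lower_running_of_avgAFH (P := ⟨K, m, g₀⟩) hrg hI (havg.mono hγle) hk
  rw [show (⟨K, m, g₀⟩ : B12.RunParams).K = K from rfl, hend] at h1
  exact h1

/-- **… in Theorem 2's quantifier shape**: for every γ ∈ ]0, γ₀] there is g₁ := (1∕γ² + D)^{−1∕2} > 0 such that for every g ∈ ]0, g₁] and every K
a bare coupling g₀ = g₀(ε, g) gives a run in ]0, γ] ending at g_K = g with (0.20) and `1∕g² + s(K − k) − D ≤ 1∕g_k² ≤ 1∕g² + β′(K − k)`, k ≤ K.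
[cite: Balaban1987RG1, Thm 2 p.259 (first sentence) and (0.31)] -/
theorem endpoint_of_avgAFH (hD : Definitions S) {γ₀ s D β' : ℝ} (hγ₀ : 0 < γ₀) (hs : 0 ≤ s) (hβ' : 0 ≤ β')
    (hcont : BetaContH γ₀ S.β) (havg : BetaAvgAFH s D γ₀ S.β) (hup : BetaUpperH β' γ₀ S.β) (m : ℕ) :
    ∀ γ : ℝ, 0 < γ → γ ≤ γ₀ → ∃ g₁ : ℝ, 0 < g₁ ∧ ∀ g : ℝ, 0 < g → g ≤ g₁ → ∀ K : ℕ, ∃ g₀ : ℝ,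
      Step.InInterval γ K (S.cpl ⟨K, m, g₀⟩) ∧ S.cpl ⟨K, m, g₀⟩ K = g ∧ FlowStep.RGEqH K S.β (S.cpl ⟨K, m, g₀⟩) ∧
        ∀ k, k ≤ K → 1 / g ^ 2 + s * ((K : ℝ) - k) - D ≤ 1 / (S.cpl ⟨K, m, g₀⟩ k) ^ 2 ∧
          1 / (S.cpl ⟨K, m, g₀⟩ k) ^ 2 ≤ 1 / g ^ 2 + β' * ((K : ℝ) - k) := by
  have hDnn : 0 ≤ D := havg.defect_nonneg hγ₀
  intro γ hγ hγle
  set g₁ : ℝ := 1 / Real.sqrt (1 / γ ^ 2 + D) with hg₁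
  have hg₁pos : 0 < g₁ := by positivity
  refine ⟨g₁, hg₁pos, fun g hg hgle K => ?_⟩
  have hgs : 1 / g₁ ^ 2 = 1 / γ ^ 2 + D := by
    rw [hg₁, div_pow, one_pow, Real.sq_sqrt (by positivity), one_div_one_div]
  have hgD : 1 / γ ^ 2 + D ≤ 1 / g ^ 2 := by
    rw [← hgs]
    exact one_div_le_one_div_of_le (by positivity) (pow_le_pow_left₀ hg.le hgle 2)
  exact firstSentence_of_avgAFH hD hγ₀ hs hβ' hcont havg hup m hγ hγle hg hgD K

/-! ## §3 Conversely: the windows of the carrier that Theorem 2 as printed does give, along the tuned runs -/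

/-- **Two runnings of one run bound every inner window sum**: (0.20) along the run + a lower running with constant b (from the END: `1∕g_K² +
b(K − k) ≤ 1∕g_k²`) + an upper running with constant c give, for k ≤ n ≤ K, `Σ_{j∈[k,n)} β_{j+1}(g₀, …, g_j) ≥ b(n − k) − (c − b)(K − n)` (write the
window as the difference of the two suffixes [k, K) and [n, K)). [cite: Balaban1987RG1, Thm 2 (0.31) p.259 with (0.20) p.256] -/
theorem window_lower_of_two_runnings {P : B12.RunParams} (hrg : FlowStep.RGEqH P.K S.β (S.cpl P)) {b b' c' c : ℝ}
    (hlo : Step.Discrete031 b b' P.K (S.cpl P P.K) (S.cpl P)) (hhi : Step.Discrete031 c' c P.K (S.cpl P P.K) (S.cpl P))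
    {k n : ℕ} (hkn : k ≤ n) (hn : n ≤ P.K) :
    b * ((n : ℝ) - k) - (c - b) * ((P.K : ℝ) - n) ≤ ∑ j ∈ Finset.Ico k n, S.β j (prefixOf (S.cpl P) j) := by
  have hsk := (suffix_bounds_of_discrete031 hrg hlo (hkn.trans hn)).1
  have hsn := (suffix_bounds_of_discrete031 hrg hhi hn).2
  have hsplit : ∑ j ∈ Finset.Ico k P.K, S.β j (prefixOf (S.cpl P) j) =
      ∑ j ∈ Finset.Ico k n, S.β j (prefixOf (S.cpl P) j) + ∑ j ∈ Finset.Ico n P.K, S.β j (prefixOf (S.cpl P) j) :=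
    (Finset.sum_Ico_consecutive _ hkn hn).symm
  have e : b * ((n : ℝ) - k) - (c - b) * ((P.K : ℝ) - n) = b * ((P.K : ℝ) - k) - c * ((P.K : ℝ) - n) := by ring
  rw [e]
  linarith

/-- **WHAT THEOREM 2 AS PRINTED GIVES OF THE END-GRADE CARRIER, ALONG ITS TUNED RUNS.**  `Theorem2Statement S hL` with prover 1's binder `hrg`
and the printed `Definitions ∧ Conclusions`: for every m, every γ ≤ min(γ₀, S.γ), every small g there is β > 0 with `β ln L ≤ β′₅₁₀` such that at
every K a bare coupling gives a run Theorem 3 speaks of, ending at g, along which EVERY window [k, n) ⊆ [0, K] has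
**`Σ_{j∈[k,n)} β_{j+1}(g₀, …, g_j) ≥ β ln L·(n − k) − (β′₅₁₀ − β ln L)·(K − n)`** — the carrier's inequality with slope β ln L and a defect
proportional to the window's distance from the END (zero for the suffixes n = K: part 1's `theorem2Statement_forces_af_steps`).  The carrier
proper (ALL box histories, a K-UNIFORM defect) is not a consequence of Theorem 2 as printed; this is the part of it that is.
[cite: Balaban1987RG1, Thm 2 (0.31) p.259 with Thm 3 p.264, (5.10) p.293 and (5.42) p.297] -/
theorem avgAF_along_tuned_of_theorem2Statement {hL : Odd S.L ∧ 1 < S.L} (h : Theorem2Statement S hL)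
    (hrg : ∀ P : B12.RunParams, Step.InInterval S.γ P.K (S.cpl P) → FlowStep.RGEqH P.K S.β (S.cpl P))
    (hD : Definitions S) (hC : Conclusions S) (m : ℕ) :
    ∃ γ₀ : ℝ, 0 < γ₀ ∧ ∀ γ : ℝ, 0 < γ → γ ≤ γ₀ → γ ≤ S.γ → ∃ g₁ : ℝ, 0 < g₁ ∧ ∀ g : ℝ, 0 < g → g ≤ g₁ →
      ∃ β : ℝ, 0 < β ∧ β * Real.log S.L ≤ betaPrime510 4 (S.C510 * S.E₀) S.δ₁ ∧ ∀ K : ℕ, ∃ g₀ : ℝ,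
        RunHyp S ⟨K, m, g₀⟩ ∧ S.cpl ⟨K, m, g₀⟩ K = g ∧ ∀ k n, k ≤ n → n ≤ K →
          β * Real.log S.L * ((n : ℝ) - k) - (betaPrime510 4 (S.C510 * S.E₀) S.δ₁ - β * Real.log S.L) * ((K : ℝ) - n) ≤
            ∑ j ∈ Finset.Ico k n, S.β j (prefixOf (S.cpl ⟨K, m, g₀⟩) j) := by
  obtain ⟨γ₀, hγ₀, hγ⟩ := theorem2_rate_le_betaPrime510 h hrg hD hC m
  refine ⟨γ₀, hγ₀, fun γ hγpos hγle hγS => ?_⟩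
  obtain ⟨g₁, hg₁, hg⟩ := hγ γ hγpos hγle hγS
  refine ⟨g₁, hg₁, fun g hgpos hgle => ?_⟩
  obtain ⟨β, β', hβ, -, hrate, hK⟩ := hg g hgpos hgle
  refine ⟨β, hβ, hrate, fun K => ?_⟩
  obtain ⟨g₀, hR, hend, h031⟩ := hK K
  refine ⟨g₀, hR, hend, fun k n hkn hn => ?_⟩
  have hP := discrete031_abs_of_conclusions hD hC hR
  have h031' : Step.Discrete031 (β * Real.log S.L) (min (β' * Real.log S.L) (betaPrime510 4 (S.C510 * S.E₀) S.δ₁))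
      (⟨K, m, g₀⟩ : B12.RunParams).K (S.cpl ⟨K, m, g₀⟩ (⟨K, m, g₀⟩ : B12.RunParams).K) (S.cpl ⟨K, m, g₀⟩) := by
    rw [show (⟨K, m, g₀⟩ : B12.RunParams).K = K from rfl, hend]
    exact h031
  exact window_lower_of_two_runnings hR.rg h031' hP hkn hn

/-! ## §4 Necessity at the END grade: the first sentence forces K-uniformly bounded-below suffix sums along its runs -/

/-- **NECESSITY AT THE END GRADE (s = 0), on the carrier.**  Along ANY run lying in ]0, γ] up to K and obeying (0.20) at its own histories,
every suffix sum of the β's is ≥ `1∕γ² − 1∕g_K²` (telescoped (0.20) + `g_k ≤ γ`; `FlowStepRuns.partialSums_lower_of_run` by name): bounded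
below UNIFORMLY IN K once the endpoint g_K = g is prescribed — the END-anchored windows of `BetaAvgAFH 0 (1∕g² − 1∕γ²)`. [cite: Balaban1987RG1, Thm 2 p.259 (first sentence) with (0.20) p.256] -/
theorem suffix_lower_of_firstSentence_run {P : B12.RunParams} {γ : ℝ} (hrg : FlowStep.RGEqH P.K S.β (S.cpl P))
    (hI : Step.InInterval γ P.K (S.cpl P)) {k : ℕ} (hk : k ≤ P.K) :
    1 / γ ^ 2 - 1 / (S.cpl P P.K) ^ 2 ≤ ∑ j ∈ Finset.Ico k P.K, S.β j (prefixOf (S.cpl P) j) :=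
  FlowStepRuns.partialSums_lower_of_run hrg hI k hk

/-- **THEOREM 2's FIRST SENTENCE FORCES K-UNIFORMLY BOUNDED-BELOW SUFFIX SUMS ALONG ITS RUNS.**  `Theorem2Statement S hL` with prover 1's binder
`hrg`: for every m, γ ≤ min(γ₀, S.γ), small g and EVERY K, the tuned run (in ]0, γ], g_K = g, a run Theorem 3 speaks of) has all suffix sums
`Σ_{j∈[k,K)} β_{j+1}(g₀, …, g_j) ≥ 1∕γ² − 1∕g²` — a bound free of K (negative: a DEFECT, no slope; the slope β ln L > 0 is what (0.31) adds, part 1).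
What no construction can avoid if it realises the first sentence: «no drift of Σβ to −∞» along the realised histories. [cite: Balaban1987RG1, Thm 2 p.259 (first sentence) with (0.20) p.256] -/
theorem firstSentence_forces_suffix_lower {hL : Odd S.L ∧ 1 < S.L} (h : Theorem2Statement S hL)
    (hrg : ∀ P : B12.RunParams, Step.InInterval S.γ P.K (S.cpl P) → FlowStep.RGEqH P.K S.β (S.cpl P)) (m : ℕ) :
    ∃ γ₀ : ℝ, 0 < γ₀ ∧ ∀ γ : ℝ, 0 < γ → γ ≤ γ₀ → γ ≤ S.γ → ∃ g₁ : ℝ, 0 < g₁ ∧ ∀ g : ℝ, 0 < g → g ≤ g₁ → ∀ K : ℕ, ∃ g₀ : ℝ,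
      RunHyp S ⟨K, m, g₀⟩ ∧ Step.InInterval γ K (S.cpl ⟨K, m, g₀⟩) ∧ S.cpl ⟨K, m, g₀⟩ K = g ∧
        ∀ k, k ≤ K → 1 / γ ^ 2 - 1 / g ^ 2 ≤ ∑ j ∈ Finset.Ico k K, S.β j (prefixOf (S.cpl ⟨K, m, g₀⟩) j) := by
  obtain ⟨γ₀, hγ₀, hγ⟩ := runHyp_of_theorem2Statement h hrg m
  refine ⟨γ₀, hγ₀, fun γ hγpos hγle hγS => ?_⟩
  obtain ⟨g₁, hg₁, hg⟩ := hγ γ hγpos hγle hγS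
  refine ⟨g₁, hg₁, fun g hgpos hgle K => ?_⟩
  obtain ⟨β, β', -, -, hK⟩ := hg g hgpos hgle
  obtain ⟨g₀, hR, hI, hend, -⟩ := hK K
  refine ⟨g₀, hR, hI, hend, fun k hk => ?_⟩
  have h1 := suffix_lower_of_firstSentence_run (P := ⟨K, m, g₀⟩) hR.rg hI hk
  rw [show (⟨K, m, g₀⟩ : B12.RunParams).K = K from rfl, hend] at h1
  exact h1

end

end Summit.QuantumFields.BalabanUV.Beta.EriceFlowEnclosureB12AsPrintedAvgAF
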